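import Summits.Ventures.PercRepro.GenQEightSixT3
import Summits.Ventures.PercRepro.GenQEightSixT4
import Summits.Ventures.PercRepro.GenQEightSixT5
import Summits.Ventures.PercRepro.GenQEightSixTrace
import Summits.Ventures.PercRepro.GenQSevenFiveTraceSums
import Summits.Ventures.PercRepro.RankLevelSetPlaneTen
import Summits.Ventures.PercRepro.Night2SevenFiveCore
import Summits.Ventures.PercRepro.Night2TraceAssembly

/-!
# PercRepro — THE `(8, 6)` ROW OF C-025 (night-4, gen 5)

C-025 at `(8, 6)` on every finite matroid, from the named input on the core — `f(4) ≤ 10` (night-1's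
`core_flat_four_le_ten`, a tree theorem) — through night-4's `rls_succ_succ_of_highLayers` at `q = 6`:

* `highLayersCoreFree_six_of_ten`: `HighLayersCoreFree 6` (the types `3, 4, 5` on the coloop-free rank-`6` flats of
  rank-`8` Core matroids) from the dual certificates of `GenQEightSixT3` / `T4` / `T5` (coranks `≤ 15, 15, 18`; the
  type-`5` window `8 … 13` on the rows of record) and THEOREM LARGE (`jq_nonneg_of_large`, the coranks beyond);
* `highLayersCoreFree_five_of_ten`: `HighLayersCoreFree 5` from night-2's `sevenFiveLayersCoreFree_of_ten`;
* `traceSumsCore_four_of_ten`: `TraceSumsCore 4` from night-2's `sevenFiveTraceSumsCore_of_ten` and night-4's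
  `traceSumsCore_four_of_sevenFive`; `TraceSumsCore 5` is `traceSumsCore_five_of_ten` (`GenQEightSixTrace`);
* `rls_eight_six_of_ten : (f(4) ≤ 10 on every Core matroid) → ∀ M, RLS M 8 6`;
* **`rls_eight_six : ∀ M, RLS M 8 6`** and `c025_eight_six`, unconditional.

Imports the four assembly modules of the cell, `GenQSevenFiveTraceSums`, `RankLevelSetPlaneTen` (night-1) and night-2's
`Night2SevenFiveCore` / `Night2TraceAssembly`.
-/
namespace PercRepro.Night4

open Finset ThmH SixFour GenQ PerFlat Star NightThree ThmN

/-- **`HighLayersCoreFree 6` from `f(4) ≤ 10`.** -/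
theorem highLayersCoreFree_six_of_ten
    (h10 : ∀ {β : Type} [DecidableEq β] (M : Matroid β) [M.Finite] {p : ℕ}, Core M p →
      ∀ F ∈ flatsQ M 4, F.card ≤ 10) : HighLayersCoreFree 6 := by
  intro β _ M _ G hc hG _ hm t ht3 ht5
  have ht : t = 3 ∨ t = 4 ∨ t = 5 := by omega
  rcases ht with rfl | rfl | rfl
  · exact jq_t3_nonneg_six_of_core_of_ten hc (h10 M hc) hG hm
  · exact jq_t4_nonneg_six_of_core_of_ten hc (h10 M hc) hG hm
  · exact jq_t5_nonneg_six_of_core_of_ten hc (h10 M hc) hG hm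

/-- **`HighLayersCoreFree 5` from `f(4) ≤ 10`** (night-2's `sevenFiveLayersCoreFree_of_ten`: the types `3, 4` on the
coloop-free rank-`5` flats of rank-`7` Core matroids). -/
theorem highLayersCoreFree_five_of_ten
    (h10 : ∀ {β : Type} [DecidableEq β] (M : Matroid β) [M.Finite] {p : ℕ}, Core M p →
      ∀ F ∈ flatsQ M 4, F.card ≤ 10) : HighLayersCoreFree 5 := by
  intro β _ M _ G hc hG _ hm t ht3 ht5
  have h := sevenFiveLayersCoreFree_of_ten h10 M G hc hG hm
  have ht : t = 3 ∨ t = 4 := by omega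
  rcases ht with rfl | rfl
  · exact h.2.1
  · exact h.2.2

/-- **`TraceSumsCore 4` from `f(4) ≤ 10`** (night-2's trace certificates through night-4's coloop bridge). -/
theorem traceSumsCore_four_of_ten
    (h10 : ∀ {β : Type} [DecidableEq β] (M : Matroid β) [M.Finite] {p : ℕ}, Core M p →
      ∀ F ∈ flatsQ M 4, F.card ≤ 10) : TraceSumsCore 4 :=
  traceSumsCore_four_of_sevenFive (sevenFiveTraceSumsCore_of_ten h10)

/-- **THE `(8, 6)` ROW OF C-025 ON EVERY FINITE MATROID, modulo `f(4) ≤ 10` on the core.** -/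
theorem rls_eight_six_of_ten {γ : Type} [DecidableEq γ]
    (h10 : ∀ {β : Type} [DecidableEq β] (M : Matroid β) [M.Finite] {p : ℕ}, Core M p →
      ∀ F ∈ flatsQ M 4, F.card ≤ 10) (M : Matroid γ) [M.Finite] : RLS M 8 6 := by
  refine rls_succ_succ_of_highLayers 6 (by norm_num) (by norm_num) ?_ ?_ M
  · intro q' h4 h5
    have hq : q' = 4 ∨ q' = 5 := by omega
    rcases hq with rfl | rfl
    · intro β _ M _ H hc hH hrH t ht
      exact traceSumsCore_four_of_ten (fun {β} [DecidableEq β] (M : Matroid β) [M.Finite] {p : ℕ} (hc : Core M p) => h10 M hc) M H hc hH hrH t ht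
    · intro β _ M _ H hc hH hrH t ht
      exact traceSumsCore_five_of_ten (fun {β} [DecidableEq β] (M : Matroid β) [M.Finite] {p : ℕ} (hc : Core M p) => h10 M hc) M H hc hH hrH t ht
  · intro q' h5 h6
    have hq : q' = 5 ∨ q' = 6 := by omega
    rcases hq with rfl | rfl
    · intro β _ M _ G hc hG h2 hm t ht3 ht
      exact highLayersCoreFree_five_of_ten (fun {β} [DecidableEq β] (M : Matroid β) [M.Finite] {p : ℕ} (hc : Core M p) => h10 M hc) M G hc hG h2 hm t ht3 ht
    · intro β _ M _ G hc hG h2 hm t ht3 ht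
      exact highLayersCoreFree_six_of_ten (fun {β} [DecidableEq β] (M : Matroid β) [M.Finite] {p : ℕ} (hc : Core M p) => h10 M hc) M G hc hG h2 hm t ht3 ht

/-- **THE `(8, 6)` ROW OF C-025 ON EVERY FINITE MATROID**: `f(4) ≤ 10` on the core is night-1's tree theorem
`core_flat_four_le_ten`. -/
theorem rls_eight_six {γ : Type} [DecidableEq γ] (M : Matroid γ) [M.Finite] : RLS M 8 6 :=
  rls_eight_six_of_ten core_flat_four_le_ten M

end PercRepro.Night4
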